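import Mathlib.Analysis.Calculus.FDeriv.Prod
import Mathlib.Analysis.Calculus.FDeriv.Comp
import Mathlib.Analysis.Calculus.FDeriv.Add
import Mathlib.Analysis.Calculus.FDeriv.Linear
import HarnessLib

/-!
# A graph-like map `(x, y) ↦ (x, f(x, y))` is submersive when the partial differential `∂_y f` is onto

Elementary calculus lemma, in the form used to check the joint-submersion hypothesis of the tangent-lift lemma
`Geometry/Manifold/SubmersionLiftVectorField` (`exists_contMDiff_lift_vectorField_tangent`) in explicit coordinates: if a map has the
block form `Φ(x, y) = (x, f(x, y))` — some coordinates are carried along unchanged — then the differential of `Φ` at `(a, b)` is onto as soon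
as the PARTIAL differential `D(f(a, ·))(b)` is onto (solve for the `y`-increment after fixing the `x`-increment; the differential of `Φ` is
block lower-triangular with an identity block). For the degeneration programme (`HodgeTheory/CyclicCoverNodalMeridianLocalMonodromyBound`)
`x = b'` are the coefficients carried along, `y` the affine coordinates, `f = (b_{x₂^p}(b', y), Σ|Θ(y)|²)`, and the partial surjectivity is
`Geometry/ComplexAnalytic/CyclicNodePencilShellSubmersion`.

* `hasFDerivAt_comp_prodMk_right` — the partial differential in `y` of `f` at `(a, b)` is `Df(a,b) ∘ (0, ·)`;
* `surjective_fderiv_graphLike` — **`D[(x, y) ↦ (x, f(x,y))](a, b)` is onto if `D[y ↦ f(a, y)](b)` is onto**;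
* `surjective_of_comp_inr_surjective` — the underlying linear algebra.

Everything is proved; no definitions, no named facts.

## References

* [BrockerJanichIDT1982] T. Bröcker, K. Jänich, Introduction to Differential Topology (1982), §5 (regular values; submersions in coordinates).
* [Milnor1968] J. Milnor, Singular Points of Complex Hypersurfaces (1968), §4–§5 (transversality of spheres to the fibres).
-/

noncomputable section

open Function

namespace Literature.Analysis.Calculus

variable {𝕜 : Type*} [NontriviallyNormedField 𝕜]
  {E₁ : Type*} [NormedAddCommGroup E₁] [NormedSpace 𝕜 E₁]
  {E₂ : Type*} [NormedAddCommGroup E₂] [NormedSpace 𝕜 E₂]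
  {F : Type*} [NormedAddCommGroup F] [NormedSpace 𝕜 F]

/-- **Linear algebra of block-triangular maps**: if `L : E₁ × E₂ → E₁ × F` has first component the first projection and
`y ↦ (L (0, y)).2` is onto, then `L` is onto. [cite: BrockerJanichIDT1982, §5] -/
theorem surjective_of_fst_eq_of_comp_inr_surjective (L : E₁ × E₂ →L[𝕜] E₁ × F) (hfst : ∀ v, (L v).1 = v.1)
    (hsurj : Surjective fun y : E₂ => (L (0, y)).2) : Surjective L := by
  rintro ⟨x, z⟩
  obtain ⟨y, hy⟩ := hsurj (z - (L (x, 0)).2)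
  refine ⟨(x, y), ?_⟩
  have hsplit : L (x, y) = L (x, 0) + L (0, y) := by
    rw [← map_add, Prod.mk_add_mk, add_zero, zero_add]
  rw [hsplit, Prod.ext_iff]
  refine ⟨?_, ?_⟩
  · simp only [Prod.fst_add, hfst, add_zero]
  · simp only [Prod.snd_add]
    change (L (x, 0)).2 + (fun y : E₂ => (L (0, y)).2) y = z
    rw [hy]; abel

/-- **The partial differential in the second variable**: if `f` has differential `f'` at `(a, b)` then `y ↦ f (a, y)` has differential
`f' ∘ (0, ·)` at `b`. [cite: BrockerJanichIDT1982, §5] -/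
theorem hasFDerivAt_comp_prodMk_right {f : E₁ × E₂ → F} {f' : E₁ × E₂ →L[𝕜] F} {a : E₁} {b : E₂}
    (hf : HasFDerivAt f f' (a, b)) :
    HasFDerivAt (fun y : E₂ => f (a, y)) (f'.comp (ContinuousLinearMap.inr 𝕜 E₁ E₂)) b :=
  hf.comp b (hasFDerivAt_prodMk_right a b)

/-- **A graph-like map is submersive when the partial differential is onto.** Let `f : E₁ × E₂ → F` be differentiable at `(a, b)` and
suppose the differential of `y ↦ f (a, y)` at `b` is onto. Then the differential of `(x, y) ↦ (x, f (x, y))` at `(a, b)` is onto.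
[cite: BrockerJanichIDT1982, §5] -/
theorem surjective_fderiv_graphLike {f : E₁ × E₂ → F} {a : E₁} {b : E₂} (hf : DifferentiableAt 𝕜 f (a, b))
    (hsurj : Surjective (fderiv 𝕜 (fun y : E₂ => f (a, y)) b)) :
    Surjective (fderiv 𝕜 (fun v : E₁ × E₂ => (v.1, f v)) (a, b)) := by
  have hΦ : HasFDerivAt (fun v : E₁ × E₂ => (v.1, f v))
      ((ContinuousLinearMap.fst 𝕜 E₁ E₂).prod (fderiv 𝕜 f (a, b))) (a, b) :=
    (hasFDerivAt_fst (𝕜 := 𝕜) (p := (a, b))).prodMk hf.hasFDerivAt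
  rw [hΦ.fderiv]
  refine surjective_of_fst_eq_of_comp_inr_surjective _ (fun v => rfl) ?_
  have hpart := (hasFDerivAt_comp_prodMk_right (𝕜 := 𝕜) hf.hasFDerivAt).fderiv
  rw [hpart] at hsurj
  intro z
  obtain ⟨y, hy⟩ := hsurj z
  exact ⟨y, hy⟩

/-- Variant with the partial differential given as a `HasFDerivAt` of `y ↦ f (a, y)`. [cite: BrockerJanichIDT1982, §5] -/
theorem surjective_fderiv_graphLike_of_hasFDerivAt {f : E₁ × E₂ → F} {a : E₁} {b : E₂} (hf : DifferentiableAt 𝕜 f (a, b))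
    {L : E₂ →L[𝕜] F} (hL : HasFDerivAt (fun y : E₂ => f (a, y)) L b) (hsurj : Surjective L) :
    Surjective (fderiv 𝕜 (fun v : E₁ × E₂ => (v.1, f v)) (a, b)) :=
  surjective_fderiv_graphLike hf (by rw [hL.fderiv]; exact hsurj)

end Literature.Analysis.Calculus

end
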